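import Mathlib
import Summits.ValiantsHypothesis.ValiantsHypothesis.Theses.ElementaryWordLength
import Literature.Computability.AlgebraicComplexity.StandardFamilies
import Literature.Computability.AlgebraicComplexity.StandardFamiliesProofs
import Literature.Computability.AlgebraicComplexity.PermanentIrreducible
import Summits.ValiantsHypothesis.ValiantsHypothesis.Theorems.ElementaryWordLengthWordLengthQPStubRealification
import Summits.ValiantsHypothesis.ValiantsHypothesis.Theorems.ElementaryWordLengthWordLengthQPStubAdjacentNormalForm
import Summits.ValiantsHypothesis.ValiantsHypothesis.Theorems.ElementaryWordLengthWordLengthQPStubUnivariateReduction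
import Summits.ValiantsHypothesis.ValiantsHypothesis.Theorems.ElementaryWordLengthWordLengthQPStubKappaGeTwo
import Summits.ValiantsHypothesis.ValiantsHypothesis.Theorems.ElementaryWordLengthWordLengthQPStubSandwich
import Summits.ValiantsHypothesis.ValiantsHypothesis.Theorems.ElementaryWordLengthWordLengthQPStubInversionCost
import Summits.ValiantsHypothesis.ValiantsHypothesis.Theorems.ElementaryWordLengthWordLengthQPStubRestriction
import Summits.ValiantsHypothesis.ValiantsHypothesis.Theorems.ElementaryWordLengthWordLengthQPNeighbourhood
import Summits.ValiantsHypothesis.ValiantsHypothesis.Theorems.ElementaryWordLengthWordLengthQPStubKappaTwoStructure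
import Summits.ValiantsHypothesis.ValiantsHypothesis.Theorems.ElementaryWordLengthWordLengthQPUnivariateWalk
import Summits.ValiantsHypothesis.ValiantsHypothesis.Theorems.ElementaryWordLengthWordLengthQPUnivariateSandwich
import Summits.ValiantsHypothesis.ValiantsHypothesis.Theorems.ElementaryWordLengthWordLengthQPUnivariateBoundedExits
import Summits.ValiantsHypothesis.ValiantsHypothesis.Theorems.ElementaryWordLengthWordLengthQPTripleProductExits
import Summits.ValiantsHypothesis.ValiantsHypothesis.Theorems.ElementaryWordLengthWordLengthQPTripleFormExits

/-!
# Skeleton of line `positive-monoid-exits` for crux `WordLengthQP` (stmt-ValiantsHypothesis-6623) — v14 (lead c6: `stub_tripleFormExits` (THEOREM M₃ for arbitrary nonnegative affine forms, ≤ 25 exits) LANDED and imported; THEOREM M₃ `stub_tripleProductExits` (κ(x_a x_b x_c) ≤ 17) LANDED p146762 and imported; THEOREM U calibration stubs `stub_univariateWalkTranslation`, `stub_univariateSandwichIdentity`, `stub_univariateBoundedExits` LANDED (p145953, p146080, p146211: Theorems/…Univariate{Walk,Sandwich,BoundedExits}.lean, imported) and the sorry-free wiring `not_univariate_hypothesis`: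 the univariate shadow of `MonomialExitLadder` is FALSE — `κ₁(t^d) ≤ 16`, `b(E₀₂(c t^d)) ≤ 3` for all `d`; v8 = lead a1: 8 stubs landed incl. RUNG 2)

Crux `X = WordLengthQP` (route `ElementaryWordLength`): the affine elementary word length of
`E₀₂(per_n)` in `E₃(ℂ[x])` is not quasi-polynomially bounded (`= ¬ (VNP ℂ ⊆ VQP ℂ)`, the Extended
Valiant Hypothesis, tree theorem `wordLengthQP_iff_extendedValiantHypothesis`, p125416).

Idea (`Ideas/positive-monoid-exits.md`, ideator 4; triage r2-1/r2-2/r2-3: pass 3/3): REALIFY, and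
instead of the LENGTH of a real word count its EXITS from Lusztig's positive monoid — the letters
that are not `E_ij(c)` / `E_ij(c·x_v)` with `c > 0` and `|i - j| = 1`.  Between two exits a word is
ONE totally nonnegative matrix over `ℝ≥0[x]` (a planar, positively weighted network), so the number
of exits is a length-free resource; the bet `S` (`SignBudget` below) is that `E₀₂(per_n)` needs
super-quasi-polynomially many exits.  `S ∧ realification → X` is pure logic (exits ≤ length).

## Composition (kernel-checked below, sorries only inside `stub_*`)

  `WordLengthQP_of : WordLengthQP :=  -- (crux unfolded) no_qpComplexWords_of_signBudget`
  `    (signBudget_of_climb stub_adjacentNormalForm stub_signBudgetClimb) stub_realification`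

* `stub_realification` (M, provable now from tree parts) — quasi-polynomial COMPLEX words for
  `E₀₂(per_n)` give quasi-polynomial REAL words: complex words ⟹ `PER ∈ VQP_ℂ`
  (`EpsOrderLadder.stub_isVQPFamily_perPoly_of_hasWords`, p125416) ⟹ `L_ℝ(per_n) ≤ 64·L_ℂ(per_n) + 6`
  (`CommExtSim.complexity_lmap_le` with the basis `{1, i}` of `ℂ/ℝ` and `φ = re`, `map_perPoly`)
  ⟹ real words of length `2^{23E²}` (`VpWordQp.hasWordAt_of_complexity_le`, any commutative ring).
* `stub_adjacentNormalForm` (M, provable now) — far letters are commutators of adjacent ones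
  (`E₀₂(a) = E₀₁(a)E₁₂(1)E₀₁(-a)E₁₂(-1)`, `E₂₀(a) = E₂₁(-1)E₁₀(-a)E₂₁(1)E₁₀(a)`) and zero letters are
  identities: every word is equivalent to one whose letters are ADJACENT with NONZERO coefficient,
  with at most twice the exits and four times the length.  In normal form an exit is exactly a
  NEGATIVE letter `S·(positive letter)·S`, `S = diag(1,-1,1)`.
* `stub_signBudgetClimb` (the bet; EVH-strength; HARDEST) — for every `c ≥ 1`, eventually in `n`,
  every normal-form real word computing `E₀₂(per_n)` has more than `2^((log₂ n + c)^c)` negative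
  letters.  `signBudget_of_climb` turns it (with the normal form) into the card's length-free
  `SignBudget` for ALL real words and all `c` (index shift `c ↦ c + 1` absorbs the factor 2).

## Calibration / infrastructure stubs (registered, NOT consumed by `WordLengthQP_of`)

* `stub_univariateReduction` (M; provable now) — `x_v ↦ t` maps words to univariate words with the same
  exits and length; hence every rung statement for nonnegative targets is equivalent to its univariate
  case and `κ(per_n) ≥ κ₁(tⁿ)`: the per/det-symmetric storey lives on width-3 words over `ℝ[t]`.

* `stub_kappaGeTwo` (rung 1; M; provable now WITHOUT total nonnegativity, triage r2-2 (ii)) — for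
  `n ≥ 2` every real word computing `E₀₂(per_n)` has ≥ 2 exits (sharp: `E₀₂(per₁)` is one far letter).
* `stub_kappaTwoStructure` (rung 2 = the `c = 0` instance of `SignBudget`; L; the first place total
  nonnegativity must do work, triage r2-1/r2-2/r2-3 "first stub") — a NONNEGATIVE polynomial `F ≠ 0`
  all of whose monomials have degree ≥ 3 has no real word with ≤ 2 exits ("with two exits the computed
  nonnegative polynomial contains a monomial of degree ≤ 2"); 8 of the 9 placements of two
  adjacent-negative exits are already excluded by support/degree (TRIAGE-r2-1), the remaining family is
  `{y₁(-α), x₂(-α)}·Q·{x₁(-β), y₂(-β)}` plus far-letter exits (TRIAGE-r2-2 (b)).  `rung_two_per`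
  below derives rung 2 for `per_n`, `n ≥ 3`, from it (sorry-free given the stub).

## Typed neighbourhood of the bet (definitions + sorry-free tripwires, for the disprover and the lead)

* `ExitToLengthNormalisation` — the FORK of the idea card ("block-length normalisation"): words with
  quasi-polynomially many exits can be replaced by words of quasi-polynomial length.  Tripwire
  `signBudget_iff_lengthBudget_of_fork`: under the fork, `SignBudget ↔ LengthBudget` (the eventual
  form of X over `ℝ`), i.e. the line would be X re-coordinatised — the moment the fork is PROVED the
  lead must report it (triage r2-1/r2-3); the moment it is REFUTED, `S` is strictly stronger than X.
* `BoundedExitGeneration` — the universal-construction failure mode (an arithmetic Markov theorem for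
  width 3): `K` exits suffice for every `per_n`.  Tripwire `not_signBudget_of_boundedExitGeneration`.
* `MonomialExitLadder` — the per/det-SYMMETRIC storey above rung 2 (triage doubt (2)): the exits of
  `E₀₂(x₁⋯x_d)` are unbounded in `d`.  By 0/1-restriction `κ(per_n) ≥ κ(x₁₁x₂₂⋯x_nn)`, so this is
  the first target above rung 2 and the cheapest structural falsifier of the whole engine; it does
  NOT imply `S` (monomials have `O(d²)` exits by Ben-Or–Cleve) and is not a stub of the composition.

Disproof used: no `Disproof.lean` exists for this crux (payload.disproof_path absent on disk,
`Cruxes/WordLengthQP/` has none, 2026-08-17T00:30Z); the sibling crux 0315's obstructions are honoured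
as on the idea card (order of `ℝ`, hence char ≠ 2; per-specific content sits in `stub_signBudgetClimb`).
Negatives index (5668, 0340, 3735, 3738): nothing on words / signs; no stub restates one.
-/

set_option linter.dupNamespace false
set_option linter.unusedVariables false

noncomputable section

namespace Summit.ValiantsHypothesis.ValiantsHypothesis.Cruxes.WordLengthQP.PositiveMonoidExits

open Literature.Computability.AlgebraicComplexity
open Summit.ValiantsHypothesis.ValiantsHypothesis.Theses.ElementaryWordLength (WordLengthQP)

/-! ## Vocabulary (local abbreviations; every `stub_*` below is stated INLINE over Mathlib + `perPoly`) -/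

/-- The matrix of a real letter `(i, j, c, v)`: the transvection `E_ij(c)` (`v = none`) or
`E_ij(c·x_v)` (`v = some v`) — the route's word predicate, over `ℝ`. -/
def letterMat {σ : Type} (l : Fin 3 × Fin 3 × ℝ × Option σ) :
    Matrix (Fin 3) (Fin 3) (MvPolynomial σ ℝ) :=
  Matrix.transvection l.1 l.2.1 (MvPolynomial.C l.2.2.1 * l.2.2.2.elim 1 MvPolynomial.X)

/-- `w` is a valid real word for `E₀₂(F)`: off-diagonal letters whose product is the transvection. -/
def IsWordFor {σ : Type} (F : MvPolynomial σ ℝ) (w : List (Fin 3 × Fin 3 × ℝ × Option σ)) : Prop :=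
  (∀ l ∈ w, l.1 ≠ l.2.1) ∧ (w.map letterMat).prod = Matrix.transvection (0 : Fin 3) 2 F

/-- Number of EXITS from Lusztig's positive monoid: letters that are NOT (`c > 0` and adjacent).
(In adjacent normal form this is the number of negative letters.) -/
def exits {σ : Type} (w : List (Fin 3 × Fin 3 × ℝ × Option σ)) : ℕ :=
  (w.filter (fun l => !decide (0 < l.2.2.1 ∧ (l.1.val + 1 = l.2.1.val ∨ l.2.1.val + 1 = l.1.val)))).length

/-- ADJACENT NORMAL FORM: every letter is `x₁, x₂, y₁, y₂`-type (`|i - j| = 1`) with nonzero coefficient. -/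
def AdjacentNF {σ : Type} (w : List (Fin 3 × Fin 3 × ℝ × Option σ)) : Prop :=
  ∀ l ∈ w, (l.1.val + 1 = l.2.1.val ∨ l.2.1.val + 1 = l.1.val) ∧ l.2.2.1 ≠ 0

/-- THE BET `S` of the idea card (length-free sign budget, all real words): for every `c`, eventually
in `n`, every real word computing `E₀₂(per_n)` has more than `2^((log₂ n + c)^c)` exits. -/
def SignBudget : Prop :=
  ∀ c : ℕ, ∃ n₀ : ℕ, ∀ n ≥ n₀, ∀ w : List (Fin 3 × Fin 3 × ℝ × Option (Fin n × Fin n)),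
    IsWordFor (perPoly (Fin n) ℝ) w → 2 ^ ((Nat.log 2 n + c) ^ c) < exits w

/-- The eventual, all-words form of X over `ℝ`: for every `c`, eventually every real word computing
`E₀₂(per_n)` is LONGER than `2^((log₂ n + c)^c)`.  (`SignBudget → LengthBudget` trivially;
`LengthBudget →` "no `c` gives real words of qp length for all `n`" trivially.) -/
def LengthBudget : Prop :=
  ∀ c : ℕ, ∃ n₀ : ℕ, ∀ n ≥ n₀, ∀ w : List (Fin 3 × Fin 3 × ℝ × Option (Fin n × Fin n)),
    IsWordFor (perPoly (Fin n) ℝ) w → 2 ^ ((Nat.log 2 n + c) ^ c) < w.length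

/-- THE FORK ("block-length normalisation", idea card §Transfer; triage r2-1 sharpen, r2-3 sharpen):
a word with quasi-polynomially many exits can be replaced by a word of quasi-polynomial length.
PROVED ⇒ `SignBudget ↔ LengthBudget` (`signBudget_iff_lengthBudget_of_fork`): the line is X
re-coordinatised by sign count and must say so.  REFUTED ⇒ long positive stretches are a genuine
resource and `S` is strictly stronger than X.  Open; the disprover's standing target. -/
def ExitToLengthNormalisation : Prop :=
  ∀ c : ℕ, ∃ c' n₁ : ℕ, ∀ n ≥ n₁, ∀ w : List (Fin 3 × Fin 3 × ℝ × Option (Fin n × Fin n)),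
    IsWordFor (perPoly (Fin n) ℝ) w → exits w ≤ 2 ^ ((Nat.log 2 n + c) ^ c) →
      ∃ w' : List (Fin 3 × Fin 3 × ℝ × Option (Fin n × Fin n)),
        IsWordFor (perPoly (Fin n) ℝ) w' ∧ w'.length ≤ 2 ^ ((Nat.log 2 n + c') ^ c')

/-- The universal-construction failure mode (an "arithmetic Markov theorem" for width 3): some fixed
number `K` of exits suffices for every `per_n` (with positive stretches of unbounded length).
It refutes `S` outright (`not_signBudget_of_boundedExitGeneration`) without touching X. -/
def BoundedExitGeneration : Prop :=
  ∃ K : ℕ, ∀ n : ℕ, ∃ w : List (Fin 3 × Fin 3 × ℝ × Option (Fin n × Fin n)),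
    IsWordFor (perPoly (Fin n) ℝ) w ∧ exits w ≤ K

/-- The MONOMIAL LADDER (per/det-symmetric storey above rung 2; first target of the TN engine beyond
`stub_kappaTwoStructure`; NOT a stub of the composition — it does not imply `S`): the number of exits
of a real word for `E₀₂(x₁x₂⋯x_d)` is unbounded in `d`.  Data (kit j020269, ±1 alphabet, length ≤ 10):
`κ(x₁x₂) = 2`, `κ(x₁x₂x₃) ≥ 5` AT LENGTH ≤ 10.  WARNING (lead c6, THEOREM U): the univariate shadow is
FALSE — `κ₁(t^d) ≤ 16` for ALL `d` (`stub_univariateBoundedExits`, `not_univariate_hypothesis` below); the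
length-≤ 10 tables (`κ₁(t³) = 5`, no word for `t⁴…t⁶`) were artefacts of the length bound (the 16-exit words have
length ≈ 4.5 d + 48).  So this ladder, if true, is true for MULTIVARIATE reasons only (number of variables, not degree). -/
def MonomialExitLadder : Prop :=
  ∀ k : ℕ, ∃ d : ℕ, ∀ w : List (Fin 3 × Fin 3 × ℝ × Option (Fin d)),
    IsWordFor (∏ i : Fin d, (MvPolynomial.X i : MvPolynomial (Fin d) ℝ)) w → k < exits w

/-- A letter is POSITIVE ADJACENT (a generator of Lusztig's monoid `𝒫`): `c > 0` and `|i - j| = 1`. -/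
def IsPosAdj {σ : Type} (l : Fin 3 × Fin 3 × ℝ × Option σ) : Prop :=
  0 < l.2.2.1 ∧ (l.1.val + 1 = l.2.1.val ∨ l.2.1.val + 1 = l.1.val)

/-- **CLAIM B2 — the first GLOBAL rung** (lead a1, analysis-a1.md §3e/§5; the disprover's standing
target from cycle 2 on): if two POSITIVE words `P, Q ∈ 𝒫` (univariate, letters `x_r(c)`, `x_r(c·t)`,
`c > 0`, `r` adjacent) satisfy `P = E₀₂(F)·Q`, then `deg F ≤ 2`; equivalently the ALTERNATION NUMBER of
`E₀₂(F)` w.r.t. `𝒫, 𝒫⁻¹` is `≥ 3` as soon as `deg F ≥ 3` (rung 2 bounds exits, not alternations, and does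
not imply this).  Evidence: no counterexample with `|P|, |Q| ≤ 8` (F a monomial) or `≤ 6` (any F) over the
unit alphabet (exhaustive, cycle 2); proved when `Q` has no `y₂`-letter (§3e).  THEOREM J (cycle 2): the
claim — like `MonomialExitLadder`, `SignBudget` and every rung `κ ≥ 9` — is FALSE modulo `t^m` for every
`m` (Lie-semigroup interior + `t ↦ λt` dilation), so any proof must be global (degree AND order AND
positivity), not `t`-adic. [folklore] -/
def ClaimB2 : Prop :=
  ∀ (P Q : List (Fin 3 × Fin 3 × ℝ × Option (Fin 1))) (F : MvPolynomial (Fin 1) ℝ),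
    (∀ l ∈ P, IsPosAdj l) → (∀ l ∈ Q, IsPosAdj l) →
    (P.map letterMat).prod = Matrix.transvection (0 : Fin 3) 2 F * (Q.map letterMat).prod →
    F.totalDegree ≤ 2

theorem exits_le_length {σ : Type} (w : List (Fin 3 × Fin 3 × ℝ × Option σ)) :
    exits w ≤ w.length :=
  List.length_filter_le _ _

/-! ## The registered stubs -/

-- `stub_realification` LANDED: Theorems/ElementaryWordLengthWordLengthQPStubRealification.lean, p134751 (imported above; same namespace, same signature).

-- `stub_adjacentNormalForm` LANDED: Theorems/ElementaryWordLengthWordLengthQPStubAdjacentNormalForm.lean, p135037 (imported above; same namespace, same signature).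

-- `stub_univariateReduction` LANDED: Theorems/ElementaryWordLengthWordLengthQPStubUnivariateReduction.lean, p135211 (imported above; same namespace, same signature).

-- `stub_kappaGeTwo` LANDED: Theorems/ElementaryWordLengthWordLengthQPStubKappaGeTwo.lean, p135670 (imported above; same namespace, same signature).

/- **Rung 2 — the κ = 2 structure theorem for nonnegative targets** (calibration; L; the first
stub where total nonnegativity must do work; TRIAGE-r2-1 sharpen / r2-2 (b) / r2-3): if `F ≠ 0` has
nonnegative coefficients and NO monomial of degree ≤ 2, then every real word computing `E₀₂(F)` has
at least three exits (arbitrary real constants, arbitrary length).  Known reduction (TRIAGE-r2-1):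
conjugating the exits `ℓ = S ℓ⁺ S` turns `P₀ℓ₁Qℓ₂P₂ = E₀₂(F)` into `ℓ₁⁺ (SQS) ℓ₂⁺ = P₀^♯ E₀₂(F) P₂^♯`
with `P^♯ = S P⁻¹ S` totally nonnegative; for two adjacent-negative exits every (row of `ℓ₁`, column
of `ℓ₂`) placement except `(1,1)` dies by support/degree, leaving `{y₁(-α), x₂(-α)}·Q·{x₁(-β), y₂(-β)}`
and the far-letter exits as a finite case analysis over coefficientwise-nonnegative matrices.
Evidence: kit j020269 (±1 alphabet, length ≤ 10: `κ(x₁x₂x₃), κ(x₁²x₂) ≥ 5`), univariate shadow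
(this seat, kit j021072, exact MITM, length ≤ 10: `κ₁(t³) = 5`, first attained at length 8, `6` at length 10;
`κ₁(t²) = 2` only at length 4; no word of length ≤ 10 for `t⁴, t⁵, t⁶`).  If a UNIVARIATE counterexample
appears, reshape to multilinear `F` (all monomials squarefree) — still covers `per_n`.
[cite: FallatJohnson2011 Thm 1.1.1, Thm 1.3.3 (`S A⁻¹ S` is TN), Thm 2.2.2 (Loewner–Whitney);
Lusztig1994; FominZelevinsky1999] -/
-- `stub_kappaTwoStructure` LANDED (RUNG 2 PROVED): Theorems/ElementaryWordLengthWordLengthQPStubKappaTwoStructure.lean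
-- (+ parts Aux, AuxB … AuxK), imported above; same namespace, same name, same signature as registered.

/-- **THE CLIMB — sign budget in adjacent normal form** (the bet; EVH-strength; HARDEST stub; no
engine beyond rung 2 is claimed): for every `c ≥ 1` there is `n₀` such that for all `n ≥ n₀` every
real word in adjacent normal form computing `E₀₂(per_n)` has more than `2^((log₂ n + c)^c)`
exits (= negative letters `S·(positive letter)·S`, `S = diag(1,-1,1)`).  Between consecutive negative
blocks the word is ONE totally nonnegative matrix over `ℝ≥0[x]`; the statement asks that
`E₀₂(per_n) ∉ (𝒫 · S𝒫S)^m` for `m` quasi-polynomial, `𝒫` = Lusztig's positive monoid of `E₃(ℝ[x])`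
generated by degree-≤1 letters.  It implies X (with the two support stubs) and, unless the FORK
`ExitToLengthNormalisation` holds, is strictly stronger; its `c = 0` instance is rung 2.
Why it might fail: a width-3 arithmetic Markov theorem (`BoundedExitGeneration`, or qp many exits
with super-qp long positive stretches) would refute it with X untouched; every rung reachable
through monomials is per/det-symmetric, so per-specific content (monotone / Jerrum–Snir-type) must
enter exactly here. [cite: Valiant1980 Lemma 3; JerrumSnir1982 §4.3; FallatJohnson2011;
BurgisserClausenShokrollahi1997 (21.32)] -/
theorem stub_signBudgetClimb (c : ℕ) (hc : 1 ≤ c) :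
    ∃ n₀ : ℕ, ∀ n ≥ n₀, ∀ w : List (Fin 3 × Fin 3 × ℝ × Option (Fin n × Fin n)),
      (∀ l ∈ w, (l.1.val + 1 = l.2.1.val ∨ l.2.1.val + 1 = l.1.val) ∧ l.2.2.1 ≠ 0) →
      (w.map (fun l => Matrix.transvection l.1 l.2.1
        (MvPolynomial.C l.2.2.1 * l.2.2.2.elim 1 MvPolynomial.X))).prod =
        Matrix.transvection (0 : Fin 3) 2 (perPoly (Fin n) ℝ) →
      2 ^ ((Nat.log 2 n + c) ^ c) <
        (w.filter (fun l => !decide (0 < l.2.2.1 ∧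
          (l.1.val + 1 = l.2.1.val ∨ l.2.1.val + 1 = l.1.val)))).length := by
  sorry

-- `stub_inversionCost` LANDED: Theorems/ElementaryWordLengthWordLengthQPStubInversionCost.lean, p136843 (imported above).

-- `stub_sandwich` LANDED: Theorems/ElementaryWordLengthWordLengthQPStubSandwich.lean, p136592 (imported above).

-- `stub_restriction` LANDED: Theorems/ElementaryWordLengthWordLengthQPStubRestriction.lean, p137088 (imported above).

-- `stub_perExitsUnbounded` LANDED with the neighbourhood wiring: Theorems/ElementaryWordLengthWordLengthQPNeighbourhood.lean, p137764 (imported above).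

/-! ## The two Steinberg commutators behind the normal form (sorry-free; for the prover of
`stub_adjacentNormalForm`) -/

/-- `E₀₂(a) = E₀₁(a) E₁₂(1) E₀₁(-a) E₁₂(-1)` in `SL₃` over any commutative ring. -/
theorem far02_eq_commutator {R : Type} [CommRing R] (a : R) :
    Matrix.transvection (0 : Fin 3) 1 a * Matrix.transvection (1 : Fin 3) 2 1 *
      Matrix.transvection (0 : Fin 3) 1 (-a) * Matrix.transvection (1 : Fin 3) 2 (-1) =
    Matrix.transvection (0 : Fin 3) 2 a := by
  ext i j
  fin_cases i <;> fin_cases j <;>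
    simp [Matrix.transvection, Matrix.mul_apply, Fin.sum_univ_three, Matrix.single,
      Matrix.of_apply, Matrix.one_apply]

/-- `E₂₀(a) = E₂₁(-1) E₁₀(-a) E₂₁(1) E₁₀(a)` in `SL₃` over any commutative ring. -/
theorem far20_eq_commutator {R : Type} [CommRing R] (a : R) :
    Matrix.transvection (2 : Fin 3) 1 (-1) * Matrix.transvection (1 : Fin 3) 0 (-a) *
      Matrix.transvection (2 : Fin 3) 1 1 * Matrix.transvection (1 : Fin 3) 0 a =
    Matrix.transvection (2 : Fin 3) 0 a := by
  ext i j
  fin_cases i <;> fin_cases j <;>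
    simp [Matrix.transvection, Matrix.mul_apply, Fin.sum_univ_three, Matrix.single,
      Matrix.of_apply, Matrix.one_apply]

/-! ## Composition (sorry-free given the stubs) -/

/-- Adjacent letters are off-diagonal. -/
theorem ne_of_adjacent {σ : Type} (l : Fin 3 × Fin 3 × ℝ × Option σ)
    (h : l.1.val + 1 = l.2.1.val ∨ l.2.1.val + 1 = l.1.val) : l.1 ≠ l.2.1 := by
  intro he
  rw [he] at h
  omega

/-- Index-shift arithmetic: `(a + 1)^(c + 1) ≥ a^c + 1` for `a ≥ 1`. -/
theorem pow_succ_succ_ge (a c : ℕ) (ha : 1 ≤ a) : a ^ c + 1 ≤ (a + 1) ^ (c + 1) := by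
  have h1 : a ^ c ≤ (a + 1) ^ c := Nat.pow_le_pow_left (Nat.le_succ a) c
  have h2 : 1 ≤ (a + 1) ^ c := Nat.one_le_pow _ _ (Nat.succ_pos a)
  calc a ^ c + 1 ≤ (a + 1) ^ c + (a + 1) ^ c := Nat.add_le_add h1 h2
    _ = (a + 1) ^ c * 2 := by ring
    _ ≤ (a + 1) ^ c * (a + 1) := Nat.mul_le_mul_left _ (by omega)
    _ = (a + 1) ^ (c + 1) := (pow_succ _ _).symm

/-- **Normal form + climb ⇒ the card's length-free sign budget `S` for all real words and all `c`.**
Given `c`, apply the climb at `c + 1` to the normal form `w'` of `w`: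
`2^((log₂ n + c + 1)^(c+1)) < exits w' ≤ 2 · exits w`, and `(log₂ n + c + 1)^(c+1) ≥ (log₂ n + c)^c + 1`
for `n ≥ 2`. -/
theorem signBudget_of_climb
    (hN : ∀ {σ : Type} (w : List (Fin 3 × Fin 3 × ℝ × Option σ)), (∀ l ∈ w, l.1 ≠ l.2.1) →
      ∃ w' : List (Fin 3 × Fin 3 × ℝ × Option σ),
        (∀ l ∈ w', (l.1.val + 1 = l.2.1.val ∨ l.2.1.val + 1 = l.1.val) ∧ l.2.2.1 ≠ 0) ∧
        (w'.map (fun l => Matrix.transvection l.1 l.2.1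
          (MvPolynomial.C l.2.2.1 * l.2.2.2.elim 1 MvPolynomial.X))).prod =
        (w.map (fun l => Matrix.transvection l.1 l.2.1
          (MvPolynomial.C l.2.2.1 * l.2.2.2.elim 1 MvPolynomial.X))).prod ∧
        (w'.filter (fun l => !decide (0 < l.2.2.1 ∧
            (l.1.val + 1 = l.2.1.val ∨ l.2.1.val + 1 = l.1.val)))).length ≤
          2 * (w.filter (fun l => !decide (0 < l.2.2.1 ∧
            (l.1.val + 1 = l.2.1.val ∨ l.2.1.val + 1 = l.1.val)))).length ∧
        w'.length ≤ 4 * w.length)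
    (hT : ∀ c : ℕ, 1 ≤ c → ∃ n₀ : ℕ, ∀ n ≥ n₀, ∀ w : List (Fin 3 × Fin 3 × ℝ × Option (Fin n × Fin n)),
      (∀ l ∈ w, (l.1.val + 1 = l.2.1.val ∨ l.2.1.val + 1 = l.1.val) ∧ l.2.2.1 ≠ 0) →
      (w.map (fun l => Matrix.transvection l.1 l.2.1
        (MvPolynomial.C l.2.2.1 * l.2.2.2.elim 1 MvPolynomial.X))).prod =
        Matrix.transvection (0 : Fin 3) 2 (perPoly (Fin n) ℝ) →
      2 ^ ((Nat.log 2 n + c) ^ c) <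
        (w.filter (fun l => !decide (0 < l.2.2.1 ∧
          (l.1.val + 1 = l.2.1.val ∨ l.2.1.val + 1 = l.1.val)))).length) :
    SignBudget := by
  intro c
  obtain ⟨n₀, hn₀⟩ := hT (c + 1) (Nat.succ_pos c)
  refine ⟨max n₀ 2, fun n hn w hw => ?_⟩
  have hn₀n : n₀ ≤ n := le_trans (le_max_left _ _) hn
  have hn2 : 2 ≤ n := le_trans (le_max_right _ _) hn
  obtain ⟨hvalid, hprod⟩ := hw
  obtain ⟨w', hadj, hprod', hexits, -⟩ := hN w hvalid
  have hcomp : (w'.map (fun l => Matrix.transvection l.1 l.2.1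
      (MvPolynomial.C l.2.2.1 * l.2.2.2.elim 1 MvPolynomial.X))).prod =
      Matrix.transvection (0 : Fin 3) 2 (perPoly (Fin n) ℝ) := by
    rw [hprod']; exact hprod
  have hlt := hn₀ n hn₀n w' hadj hcomp
  -- arithmetic: 2^((log n + c)^c) < exits w
  have hlog : 1 ≤ Nat.log 2 n := Nat.le_log_of_pow_le (by norm_num) (by simpa using hn2)
  have hE : (Nat.log 2 n + c) ^ c + 1 ≤ (Nat.log 2 n + (c + 1)) ^ (c + 1) := by
    have := pow_succ_succ_ge (Nat.log 2 n + c) c (by omega)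
    simpa [Nat.add_assoc] using this
  have hpow : 2 ^ ((Nat.log 2 n + c) ^ c + 1) ≤ 2 ^ ((Nat.log 2 n + (c + 1)) ^ (c + 1)) :=
    Nat.pow_le_pow_right (by norm_num) hE
  show 2 ^ ((Nat.log 2 n + c) ^ c) < exits w
  unfold exits
  rw [pow_succ] at hpow
  omega

/-- **`S` + realification ⇒ no quasi-polynomial complex words** (pure logic: exits ≤ length; the
ideator's `wordLengthQP_of_signBudget`, Sketch_ideator4.lean).  Stated with the crux UNFOLDED so
that `WordLengthQP_of` below is the only theorem of this file concluding the crux by name. -/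
theorem no_qpComplexWords_of_signBudget (hS : SignBudget)
    (hR : (∃ c : ℕ, ∀ n : ℕ, ∃ w : List (Fin 3 × Fin 3 × ℂ × Option (Fin n × Fin n)),
      w.length ≤ 2 ^ ((Nat.log 2 n + c) ^ c) ∧ (∀ l ∈ w, l.1 ≠ l.2.1) ∧
      (w.map (fun l => Matrix.transvection l.1 l.2.1
        (MvPolynomial.C l.2.2.1 * l.2.2.2.elim 1 MvPolynomial.X))).prod =
        Matrix.transvection (0 : Fin 3) 2 (perPoly (Fin n) ℂ)) →
    ∃ c : ℕ, ∀ n : ℕ, ∃ w : List (Fin 3 × Fin 3 × ℝ × Option (Fin n × Fin n)),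
      w.length ≤ 2 ^ ((Nat.log 2 n + c) ^ c) ∧ (∀ l ∈ w, l.1 ≠ l.2.1) ∧
      (w.map (fun l => Matrix.transvection l.1 l.2.1
        (MvPolynomial.C l.2.2.1 * l.2.2.2.elim 1 MvPolynomial.X))).prod =
        Matrix.transvection (0 : Fin 3) 2 (perPoly (Fin n) ℝ)) :
    ¬ ∃ c : ℕ, ∀ n : ℕ, (∃ w : List (Fin 3 × Fin 3 × ℂ × Option (Fin n × Fin n)),
      w.length ≤ 2 ^ ((Nat.log 2 n + c) ^ c) ∧ (∀ l ∈ w, l.1 ≠ l.2.1) ∧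
      (w.map (fun l => Matrix.transvection l.1 l.2.1
        (MvPolynomial.C l.2.2.1 * l.2.2.2.elim 1 MvPolynomial.X))).prod =
        Matrix.transvection (0 : Fin 3) 2 (perPoly (Fin n) ℂ)) := by
  intro hC
  obtain ⟨c, hc⟩ := hR hC
  obtain ⟨n₀, hn₀⟩ := hS c
  obtain ⟨w, hwlen, hvalid, hprod⟩ := hc n₀
  have h1 := hn₀ n₀ le_rfl w ⟨hvalid, hprod⟩
  have h2 := exits_le_length w
  omega

/-- **The composition**: the crux BY NAME from the three load-bearing stubs
(`stub_adjacentNormalForm`, `stub_signBudgetClimb`, `stub_realification`). -/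
theorem WordLengthQP_of : WordLengthQP := by
  unfold Summit.ValiantsHypothesis.ValiantsHypothesis.Theses.ElementaryWordLength.WordLengthQP
  exact no_qpComplexWords_of_signBudget
    (signBudget_of_climb (fun w hw => stub_adjacentNormalForm w hw) stub_signBudgetClimb)
    stub_realification

/-! ## Tripwires and calibration consequences (sorry-free given the stubs they name) -/

/-- `S` is at least the eventual length budget (exits ≤ length). -/
theorem lengthBudget_of_signBudget (hS : SignBudget) : LengthBudget := by
  intro c
  obtain ⟨n₀, hn₀⟩ := hS c
  exact ⟨n₀, fun n hn w hw => lt_of_lt_of_le (hn₀ n hn w hw) (exits_le_length w)⟩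

/-- **FORK tripwire**: under exit-to-length normalisation the bet `S` is EQUIVALENT to the eventual
length budget (X over `ℝ` in its all-`n` form) — the line would then be X re-coordinatised by sign
count (TRIAGE-r2-1 doubt (3)); report it the moment `ExitToLengthNormalisation` is proved. -/
theorem signBudget_iff_lengthBudget_of_fork (hF : ExitToLengthNormalisation) :
    SignBudget ↔ LengthBudget := by
  refine ⟨lengthBudget_of_signBudget, fun hL c => ?_⟩
  obtain ⟨c', n₁, hn₁⟩ := hF c
  obtain ⟨n₀, hn₀⟩ := hL c'
  refine ⟨max n₀ n₁, fun n hn w hw => ?_⟩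
  by_contra hle
  have hle' : exits w ≤ 2 ^ ((Nat.log 2 n + c) ^ c) := not_lt.mp hle
  obtain ⟨w', hw', hlen⟩ := hn₁ n (le_trans (le_max_right _ _) hn) w hw hle'
  have := hn₀ n (le_trans (le_max_left _ _) hn) w' hw'
  omega

/-- **The FORK is not an independent target (lead a1)**: it is implied by `S` itself (vacuously:
beyond `n₀(c)` no word has few exits) … -/
theorem exitToLengthNormalisation_of_signBudget (hS : SignBudget) : ExitToLengthNormalisation := by
  intro c
  obtain ⟨n₀, hn₀⟩ := hS c
  refine ⟨c, n₀, fun n hn w hw hle => ?_⟩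
  exact absurd (hn₀ n hn w hw) (not_lt.mpr hle)

/-- … and by the NEGATION of the (realified, all-`n`) crux: if quasi-polynomial real words exist for
every `n`, they serve as the short replacement.  So `(¬X_ℝ ∨ S) → FORK → (LengthBudget → S)`
(`signBudget_iff_lengthBudget_of_fork`): deciding the FORK is deciding whether `S` is equivalent to
the length statement, nothing less. -/
theorem exitToLengthNormalisation_of_qpRealWords
    (h : ∃ c : ℕ, ∀ n : ℕ, ∃ w : List (Fin 3 × Fin 3 × ℝ × Option (Fin n × Fin n)),
      IsWordFor (perPoly (Fin n) ℝ) w ∧ w.length ≤ 2 ^ ((Nat.log 2 n + c) ^ c)) :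
    ExitToLengthNormalisation := by
  obtain ⟨c₀, hc₀⟩ := h
  intro _c
  refine ⟨c₀, 0, fun n _hn _w _hw _hle => ?_⟩
  obtain ⟨w', hw', hlen⟩ := hc₀ n
  exact ⟨w', hw', hlen⟩

/-- **Bounded-generation tripwire**: a fixed number of exits for every `per_n` refutes `S`. -/
theorem not_signBudget_of_boundedExitGeneration (hB : BoundedExitGeneration) : ¬ SignBudget := by
  intro hS
  obtain ⟨K, hK⟩ := hB
  obtain ⟨n₀, hn₀⟩ := hS K
  obtain ⟨w, hw, hle⟩ := hK n₀
  have hlt := hn₀ n₀ le_rfl w hw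
  have hKle : K ≤ 2 ^ ((Nat.log 2 n₀ + K) ^ K) := by
    rcases Nat.eq_zero_or_pos K with rfl | hKpos
    · exact Nat.zero_le _
    · calc K ≤ K ^ K := Nat.le_self_pow (Nat.pos_iff_ne_zero.1 hKpos) K
        _ ≤ (Nat.log 2 n₀ + K) ^ K := Nat.pow_le_pow_left (Nat.le_add_left _ _) K
        _ ≤ 2 ^ ((Nat.log 2 n₀ + K) ^ K) := le_of_lt (Nat.lt_two_pow_self)
  omega

/-- The permanent over `ℝ` has nonnegative coefficients. -/
theorem coeff_perPoly_nonneg (n : ℕ) (m : (Fin n × Fin n) →₀ ℕ) :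
    0 ≤ (perPoly (Fin n) ℝ).coeff m := by
  rw [coeff_perPoly]
  exact Finset.sum_nonneg fun ρ _ => by split_ifs <;> norm_num

/-- Every monomial of `per_n` has degree `n`. -/
theorem degree_of_mem_support_perPoly (n : ℕ) (m : (Fin n × Fin n) →₀ ℕ)
    (hm : m ∈ (perPoly (Fin n) ℝ).support) : m.degree = n := by
  have hhom := perPoly_isHomogeneous (n := Fin n) (k := ℝ)
  have hcoeff : (perPoly (Fin n) ℝ).coeff m ≠ 0 := MvPolynomial.mem_support_iff.1 hm
  have h := hhom hcoeff
  rw [Finsupp.degree_eq_weight_one]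
  have h1 : (fun _ : Fin n × Fin n => (1 : ℕ)) = (1 : Fin n × Fin n → ℕ) := rfl
  rw [h1, h, Fintype.card_fin]

/-- **Rung 2 for the permanent** from the structure theorem: for `n ≥ 3` every real word computing
`E₀₂(per_n)` has at least three exits (the `c = 0` instance of `SignBudget`, for all `n ≥ 3`). -/
theorem rung_two_per (n : ℕ) (hn : 3 ≤ n) (w : List (Fin 3 × Fin 3 × ℝ × Option (Fin n × Fin n)))
    (hw : IsWordFor (perPoly (Fin n) ℝ) w) : 3 ≤ exits w := by
  obtain ⟨hvalid, hprod⟩ := hw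
  refine stub_kappaTwoStructure (perPoly (Fin n) ℝ) (coeff_perPoly_nonneg n) ?_
    (perPoly_ne_zero (Fin n) ℝ) w hvalid hprod
  intro m hm
  rw [degree_of_mem_support_perPoly n m hm]
  exact hn

/-- **The monomial ladder follows from its univariate shadow** (tripwire wiring, via the LANDED
`stub_univariateReduction`): if for every `k` some power `t^d` needs more than `k` exits in the
univariate arena (`σ = Fin 1`, `x_v ↦ t`), then `MonomialExitLadder` holds — a word for
`E₀₂(x₁⋯x_d)` maps to a word for `E₀₂(t^d)` with the same exits.  So the kit tables `κ₁(t^D)`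
(j021072, j021256) are lower-bound evidence for the ladder itself, not only for its shadow. -/
theorem monomialExitLadder_of_univariate
    (H : ∀ k : ℕ, ∃ d : ℕ, ∀ w₁ : List (Fin 3 × Fin 3 × ℝ × Option (Fin 1)),
      (∀ l ∈ w₁, l.1 ≠ l.2.1) →
      (w₁.map (fun l => Matrix.transvection l.1 l.2.1
        (MvPolynomial.C l.2.2.1 * l.2.2.2.elim 1 MvPolynomial.X))).prod =
        Matrix.transvection (0 : Fin 3) 2 ((MvPolynomial.X 0 : MvPolynomial (Fin 1) ℝ) ^ d) →
      k < exits w₁) :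
    MonomialExitLadder := by
  intro k
  obtain ⟨d, hd⟩ := H k
  refine ⟨d, fun w hw => ?_⟩
  obtain ⟨hvalid, hprod⟩ := hw
  obtain ⟨w₁, hvalid₁, hprod₁, hexits₁, -⟩ := stub_univariateReduction _ w hvalid hprod
  have hren : MvPolynomial.rename (fun _ : Fin d => (0 : Fin 1))
      (∏ i : Fin d, (MvPolynomial.X i : MvPolynomial (Fin d) ℝ)) =
      (MvPolynomial.X 0 : MvPolynomial (Fin 1) ℝ) ^ d := by
    rw [map_prod]
    simp [MvPolynomial.rename_X, Finset.prod_const]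
  rw [hren] at hprod₁
  have h := hd w₁ hvalid₁ hprod₁
  unfold exits at h ⊢
  rw [hexits₁] at h
  exact h

/-- The diagonal restriction of the generic permanent: killing the off-diagonal variables and
renaming `x_ii ↦ x_i` sends `per_n` to the monomial `x₀ x₁ ⋯ x_{n-1}`. [folklore] -/
theorem aeval_diag_perPoly (n : ℕ) :
    MvPolynomial.aeval (fun v : Fin n × Fin n =>
        (if v.1 = v.2 then some (some v.1) else (none : Option (Option (Fin n)))).elim
          (0 : MvPolynomial (Fin n) ℝ) (fun o => o.elim 1 MvPolynomial.X)) (perPoly (Fin n) ℝ) =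
      ∏ i : Fin n, (MvPolynomial.X i : MvPolynomial (Fin n) ℝ) := by
  have hmat : (Matrix.mvPolynomialX (Fin n) (Fin n) ℝ).map
      (MvPolynomial.aeval (fun v : Fin n × Fin n =>
        (if v.1 = v.2 then some (some v.1) else (none : Option (Option (Fin n)))).elim
          (0 : MvPolynomial (Fin n) ℝ) (fun o => o.elim 1 MvPolynomial.X))) =
      Matrix.diagonal (fun i : Fin n => (MvPolynomial.X i : MvPolynomial (Fin n) ℝ)) := by
    ext i j
    by_cases hij : i = j
    · subst hij; simp [Matrix.mvPolynomialX]
    · simp [Matrix.mvPolynomialX, hij]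
  unfold perPoly
  rw [Matrix.permanent, map_sum]
  simp_rw [map_prod]
  have h2 : ∀ (ρ : Equiv.Perm (Fin n)) (i : Fin n),
      (MvPolynomial.aeval (fun v : Fin n × Fin n =>
        (if v.1 = v.2 then some (some v.1) else (none : Option (Option (Fin n)))).elim
          (0 : MvPolynomial (Fin n) ℝ) (fun o => o.elim 1 MvPolynomial.X)))
        (Matrix.mvPolynomialX (Fin n) (Fin n) ℝ (ρ i) i) =
      (Matrix.diagonal (fun i : Fin n => (MvPolynomial.X i : MvPolynomial (Fin n) ℝ))) (ρ i) i := by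
    intro ρ i
    have := congrFun (congrFun hmat (ρ i)) i
    simpa [Matrix.map_apply] using this
  simp_rw [h2]
  rw [← Matrix.permanent, Matrix.permanent_diagonal]

/-- **0/1-restriction**: a real word for `E₀₂(per_n)` yields a real word for `E₀₂(x₀⋯x_{n-1})` (over
`Fin n`) with no more exits — so `κ(per_n) ≥ κ(x₁⋯x_n)` (from `stub_restriction`). [folklore] -/
theorem exists_word_prodX_of_isWordFor_per (n : ℕ) (w : List (Fin 3 × Fin 3 × ℝ × Option (Fin n × Fin n)))
    (hw : IsWordFor (perPoly (Fin n) ℝ) w) :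
    ∃ w₁ : List (Fin 3 × Fin 3 × ℝ × Option (Fin n)),
      IsWordFor (∏ i : Fin n, (MvPolynomial.X i : MvPolynomial (Fin n) ℝ)) w₁ ∧ exits w₁ ≤ exits w := by
  obtain ⟨hvalid, hprod⟩ := hw
  obtain ⟨w₁, hvalid₁, hprod₁, hexits₁, -⟩ :=
    stub_restriction (fun v : Fin n × Fin n =>
      if v.1 = v.2 then some (some v.1) else (none : Option (Option (Fin n)))) _ w hvalid hprod
  rw [aeval_diag_perPoly] at hprod₁
  exact ⟨w₁, ⟨hvalid₁, hprod₁⟩, hexits₁⟩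

/-- **Tripwire wiring**: the monomial ladder refutes the universal-construction failure mode —
`MonomialExitLadder → ¬ BoundedExitGeneration` (a fixed number of exits cannot serve every `per_n`,
since `κ(per_n) ≥ κ(x₁⋯x_n) → ∞`).  With `monomialExitLadder_of_univariate`: growth of the univariate
table `κ₁(t^D)` alone kills `BoundedExitGeneration`. [folklore] -/
theorem not_boundedExitGeneration_of_monomialExitLadder (hM : MonomialExitLadder) :
    ¬ BoundedExitGeneration := by
  rintro ⟨K, hK⟩
  obtain ⟨d, hd⟩ := hM K
  obtain ⟨w, hw, hle⟩ := hK d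
  obtain ⟨w₁, hw₁, hexits⟩ := exists_word_prodX_of_isWordFor_per d w hw
  have := hd w₁ hw₁
  omega

-- `aeval_diag_perPoly_le` LANDED in …Neighbourhood.lean (p137764).

/-- **Tripwire wiring — the constant storey of `S`**: under `MonomialExitLadder`, the sign budget of
the permanent is EVENTUALLY UNBOUNDED: for every `K`, all real words computing `E₀₂(per_n)` have more
than `K` exits for all large `n` (restrict `per_n ↦ x₀⋯x_{d-1}` by `stub_restriction` and
`aeval_diag_perPoly_le`).  This is every fixed rung of the climb at once, conditionally on the
(per/det-symmetric) monomial ladder; the super-quasi-polynomial rate is exactly what remains of S.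
[folklore] -/
theorem signBudget_unbounded_of_monomialExitLadder (hM : MonomialExitLadder) (K : ℕ) :
    ∃ n₀ : ℕ, ∀ n ≥ n₀, ∀ w : List (Fin 3 × Fin 3 × ℝ × Option (Fin n × Fin n)),
      IsWordFor (perPoly (Fin n) ℝ) w → K < exits w := by
  obtain ⟨d, hd⟩ := hM K
  refine ⟨d, fun n hn w hw => ?_⟩
  obtain ⟨hvalid, hprod⟩ := hw
  obtain ⟨w₁, hvalid₁, hprod₁, hexits₁, -⟩ :=
    stub_restriction (fun v : Fin n × Fin n =>
      if v.1 = v.2 then (if h : v.1.val < d then some (some (⟨v.1.val, h⟩ : Fin d)) else some none)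
        else (none : Option (Option (Fin d)))) _ w hvalid hprod
  rw [aeval_diag_perPoly_le d n hn] at hprod₁
  have h1 := hd w₁ ⟨hvalid₁, hprod₁⟩
  have h2 : exits w₁ ≤ exits w := hexits₁
  omega

/-- Rung 1 in the local vocabulary (from `stub_kappaGeTwo`). -/
theorem rung_one_per (n : ℕ) (hn : 2 ≤ n) (w : List (Fin 3 × Fin 3 × ℝ × Option (Fin n × Fin n)))
    (hw : IsWordFor (perPoly (Fin n) ℝ) w) : 2 ≤ exits w :=
  stub_kappaGeTwo n hn w hw.1 hw.2


/-! ## Calibration stubs of lead c6 (THEOREM U: the univariate arena is exit-bounded) -/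

-- `stub_univariateWalkTranslation` LANDED: Theorems/ElementaryWordLengthWordLengthQPUnivariateWalk.lean (lead c6; imported above; same namespace, same signature).

-- `stub_univariateSandwichIdentity` LANDED: Theorems/ElementaryWordLengthWordLengthQPUnivariateSandwich.lean (lead c6; imported above; same namespace, same signature).

-- `stub_univariateBoundedExits` LANDED: Theorems/ElementaryWordLengthWordLengthQPUnivariateBoundedExits.lean (lead c6; imported above; same namespace, same signature).

-- `stub_tripleProductExits` LANDED: Theorems/ElementaryWordLengthWordLengthQPTripleProductExits.lean (lead c6, p146762; imported above; same namespace, same signature): κ(x_a x_b x_c) ≤ 17.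

-- `stub_tripleFormExits` LANDED: Theorems/ElementaryWordLengthWordLengthQPTripleFormExits.lean (lead c6; imported above; same namespace, same signature): ≤ 25 exits for E₀₂(pqr), p q r nonnegative affine forms.


/-- **The univariate shadow is dead (lead c6).**  Hypothesis `H` of `monomialExitLadder_of_univariate`
("for every `k` some `t^d` needs more than `k` exits in the univariate arena") is FALSE: by
`stub_univariateBoundedExits` every `E₀₂(t^d)` has a word with at most 16 exits.  So the univariate
reduction (`stub_univariateReduction`) and 0/1-restriction (`stub_restriction`) routes certify at most
16 exits for `E₀₂(per_n)`, and the kit tables `κ₁(t^D)` (j021072, j021256, j021659) are no evidence for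
`MonomialExitLadder`; any engine for `S` must be genuinely multivariate. [folklore] -/
theorem not_univariate_hypothesis :
    ¬ (∀ k : ℕ, ∃ d : ℕ, ∀ w₁ : List (Fin 3 × Fin 3 × ℝ × Option (Fin 1)),
      (∀ l ∈ w₁, l.1 ≠ l.2.1) →
      (w₁.map (fun l => Matrix.transvection l.1 l.2.1
        (MvPolynomial.C l.2.2.1 * l.2.2.2.elim 1 MvPolynomial.X))).prod =
        Matrix.transvection (0 : Fin 3) 2 ((MvPolynomial.X 0 : MvPolynomial (Fin 1) ℝ) ^ d) →
      k < exits w₁) := by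
  intro h
  obtain ⟨d, hd⟩ := h 16
  obtain ⟨w₁, hv, hp, hle⟩ := stub_univariateBoundedExits d
  have h16 := hd w₁ hv hp
  unfold exits at h16
  omega

end Summit.ValiantsHypothesis.ValiantsHypothesis.Cruxes.WordLengthQP.PositiveMonoidExits

end
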